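import Mathlib
import Summits.CriticalPhenomena.PercolationContinuityZ3.Theorems.PercNearOneGluingNoHeavyLowerTailHypergeomSums
import HarnessLib

/-!
# The birth–death (three-term) recurrence of `m ↦ ₂F₁(a, −m; c; g)`

Support file for the Sahi / Conjecture-P programme of route `PercNearOneGluingNoHeavy`
(`--supports stmt-CriticalPhenomena-4575`, prover prim-l12-p5 gen 39; proof note
`prim-l12-p5/PROOF-BRANCHING-DICTIONARY-g39.md` §1).  No definitions, no named facts, no sorries.

With `H a c r = ₂F₁(a, −r; c; g)` (the defining hypothesis `hH` of `…LowerTailHypergeomSums`) and `ν := −a`,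
the positive recurrence (`hyp_posrec`) and c-contiguity (`hyp_c_contig` of `…OddsBernsteinX`, reproduced here as a private
lemma so that the file depends on `…HypergeomSums` only) combine to the THREE-TERM RECURRENCE IN `r`

  `(c + m) · H a c (m+1) − (c − a g + m (2 − g)) · H a c m + (1 − g) m · H a c (m−1) = 0`   (`m ≥ 1`),

i.e. `m ↦ Q_ν(m) = ₂F₁(−ν, −m; c; g)` is the `νg`-eigenfunction of the birth–death chain on `ℕ` with birth rates
`λ_m = m + c` and death rates `μ_m = (1−g) m` (the linear birth–death process with immigration `c`, per-capita birth
rate `1`, death rate `1−g`): `λ_m (Q(m+1) − Q(m)) + μ_m (Q(m−1) − Q(m)) = νg · Q(m)`.  This is the dictionary behind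
`1/Q_θ(m) = E_0[e^{−θg T_{0→m}}]` (first-passage Laplace transform) and `Q_ν(m) = E_m[W^ν]/E_0[W^ν]` of the memo.
We state it with `m = r+1` (no truncated subtraction): `hyp_three_term` (multiplied by `c`) and `hyp_three_term'`,
and the generator form `hyp_birthDeath_eigen`.
-/

namespace Summit.CriticalPhenomena.PercolationContinuityZ3.Theorems

namespace HypergeomCM

open Finset
open scoped Nat

section

variable (g : ℝ) (H : ℝ → ℝ → ℕ → ℝ)
  (hH : ∀ a c r, H a c r = ∑ k ∈ range (r + 1), (r.choose k : ℝ) * (-g) ^ k *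
    ((∏ i ∈ range k, (a + i)) / (∏ i ∈ range k, (c + i))))
include hH

/-- Local copy of c-contiguity (`hyp_c_contig` of `…LowerTailOddsBernsteinX`, prim-l12-p5 gen 37), reproduced privately so that
this file depends only on `…LowerTailHypergeomSums`:
`c·(H a c (r+1) - H a (c+1) (r+1)) = (r+1)·(H a (c+1) (r+1) - H a (c+1) r)`. -/
private theorem hyp_c_contig_loc (a c : ℝ) (hc : 0 < c) (r : ℕ) :
    c * (H a c (r + 1) - H a (c + 1) (r + 1)) = ((r : ℝ) + 1) * (H a (c + 1) (r + 1) - H a (c + 1) r) := by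
  have hr : H a (c + 1) r = ∑ k ∈ range (r + 1 + 1), (r.choose k : ℝ) * (-g) ^ k *
      ((∏ i ∈ range k, (a + i)) / (∏ i ∈ range k, (c + 1 + i))) := by
    rw [hH a (c + 1) r, sum_range_succ _ (r + 1), Nat.choose_eq_zero_of_lt (Nat.lt_succ_self r)]
    simp
  rw [hH a c (r + 1), hH a (c + 1) (r + 1), hr, ← sum_sub_distrib, ← sum_sub_distrib, mul_sum, mul_sum]
  refine sum_congr rfl fun k _ => ?_
  have e1 : ((r : ℝ) + 1) * (((r + 1).choose k : ℝ) - (r.choose k : ℝ)) = (k : ℝ) * ((r + 1).choose k : ℝ) := by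
    rcases k with _ | k
    · simp
    · have h1 : (r + 1).choose (k + 1) = r.choose k + r.choose (k + 1) := Nat.choose_succ_succ' r k
      have h2 : (r + 1) * r.choose k = (r + 1).choose (k + 1) * (k + 1) := Nat.add_one_mul_choose_eq r k
      have h1' : (((r + 1).choose (k + 1) : ℕ) : ℝ) = (r.choose k : ℝ) + (r.choose (k + 1) : ℝ) := by
        exact_mod_cast h1
      have h2' : ((r : ℝ) + 1) * (r.choose k : ℝ) = (((r + 1).choose (k + 1) : ℕ) : ℝ) * ((k : ℝ) + 1) := by
        exact_mod_cast h2
      push_cast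
      linear_combination ((r : ℝ) + 1) * h1' + h2'
  have e2 : c * ∏ i ∈ range k, (c + 1 + (i : ℝ)) = (∏ i ∈ range k, (c + (i : ℝ))) * (c + k) := by
    rw [← prod_succ_shift c k, prod_range_succ]
  have hPc : (∏ i ∈ range k, (c + (i : ℝ))) ≠ 0 := (prod_pos_of_pos c hc k).ne'
  have hPc1 : (∏ i ∈ range k, (c + 1 + (i : ℝ))) ≠ 0 := (prod_pos_of_pos (c + 1) (by linarith) k).ne'
  have hck : (c + (k : ℝ)) ≠ 0 := by positivity
  have q : ((∏ i ∈ range k, (c + (i : ℝ))))⁻¹ = (c + k) * (c * ∏ i ∈ range k, (c + 1 + (i : ℝ)))⁻¹ := by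
    rw [e2, mul_inv, ← mul_assoc, mul_comm (c + (k : ℝ)), mul_assoc, mul_inv_cancel₀ hck, mul_one]
  rw [div_eq_mul_inv, div_eq_mul_inv, q, mul_inv]
  field_simp
  linear_combination -((-g) ^ k * (∏ i ∈ range k, (a + (i : ℝ)))) * e1

/-- **Three-term recurrence** (times `c`): for `c > 0` and every `r`,
`c (c+r+1) H a c (r+2) − c (c − a g + (r+1)(2−g)) H a c (r+1) + c (1−g)(r+1) H a c r = 0`.
Proof: `(c+r+1)·posrec(r+1) − g(c−a)·c_contig(r) − (r+1)·posrec(r)`. -/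
theorem hyp_three_term (a c : ℝ) (hc : 0 < c) (r : ℕ) :
    c * (c + r + 1) * H a c (r + 2) - c * (c - a * g + ((r : ℝ) + 1) * (2 - g)) * H a c (r + 1)
      + c * (1 - g) * ((r : ℝ) + 1) * H a c r = 0 := by
  have e1 := hyp_posrec g H hH a c hc (r + 1)
  have e2 := hyp_c_contig_loc g H hH a c hc r
  have e3 := hyp_posrec g H hH a c hc r
  have h12 : r + 1 + 1 = r + 2 := rfl
  rw [h12] at e1
  linear_combination (c + (r : ℝ) + 1) * e1 - g * (c - a) * e2 - ((r : ℝ) + 1) * e3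

/-- **Three-term recurrence**: for `c > 0` and every `r`,
`(c+r+1) H a c (r+2) − (c − a g + (r+1)(2−g)) H a c (r+1) + (1−g)(r+1) H a c r = 0`. -/
theorem hyp_three_term' (a c : ℝ) (hc : 0 < c) (r : ℕ) :
    (c + r + 1) * H a c (r + 2) - (c - a * g + ((r : ℝ) + 1) * (2 - g)) * H a c (r + 1)
      + (1 - g) * ((r : ℝ) + 1) * H a c r = 0 := by
  have h := hyp_three_term g H hH a c hc r
  have hc0 : c ≠ 0 := hc.ne'
  have : c * ((c + r + 1) * H a c (r + 2) - (c - a * g + ((r : ℝ) + 1) * (2 - g)) * H a c (r + 1)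
      + (1 - g) * ((r : ℝ) + 1) * H a c r) = 0 := by linear_combination h
  rcases mul_eq_zero.mp this with h0 | h0
  · exact absurd h0 hc0
  · exact h0

/-- **Birth–death eigen-equation**: with birth rate `λ_m = m + c`, death rate `μ_m = (1−g) m` and `ν = −a`,
`λ_m (H a c (m+1) − H a c m) + μ_m (H a c (m−1) − H a c m) = ν g · H a c m` at `m = r+1`. -/
theorem hyp_birthDeath_eigen (a c : ℝ) (hc : 0 < c) (r : ℕ) :
    (((r : ℝ) + 1) + c) * (H a c (r + 2) - H a c (r + 1))
      + (1 - g) * ((r : ℝ) + 1) * (H a c r - H a c (r + 1)) = (-a) * g * H a c (r + 1) := by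
  linear_combination hyp_three_term' g H hH a c hc r

end

end HypergeomCM

end Summit.CriticalPhenomena.PercolationContinuityZ3.Theorems
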